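import Summits.FinalStateConjecture.FinalStateConjecture.Theses.StarvedNecks
import Literature.Geometry.Lorentzian.MinkowskiGlobalHyperbolicity
import Literature.Geometry.Lorentzian.CausalFutureProofs

/-!
# Sketch — crux-ideate `one-curve-dichotomy` for `StarvedNecks.SeamedChartsExhaust` (item stmt-FinalStateConjecture-13551)

First lemmas of the line (signatures only; `sorry` bodies). The kernel is abstract Lorentzian causality;
`HcPred`/`SmPred` are verbatim copies of the crux's let-bound hypothesis predicates.
-/

noncomputable section

namespace Summit.FinalStateConjecture.FinalStateConjecture.Cruxes.SeamedChartsExhaust.OneCurveDichotomy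

open scoped BigOperators Topology Manifold Classical ContDiff ENNReal
open Filter Set Function TopologicalSpace
open Literature.Geometry.Lorentzian

/-- KERNEL (one-curve dichotomy), abstract over any spacetime: if the charted region `C` is open,
charted non-late points reach the slab (`K1`) and uncharted exterior points in the closure of the
certified-late region reach the slab (`K2`), then every exterior point outside the certified-late
region `F` reaches the slab `S`. Here "exterior" = `J⁺(A) ∩ I⁻(C)`. No global hyperbolicity, no
push-up, no openness of `I±` is needed: only `I ⊆ J`, `J ∘ J = J`, restriction and continuity of
one timelike curve, and openness of `C`. -/
theorem kernel_dichotomy (𝓢 : Spacetime.{0} 4) (A C F S : Set 𝓢.carrier) (hC : IsOpen C)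
    (K1 : C \ F ⊆ 𝓢.metric.causalPast 𝓢.timeOrientation S)
    (K2 : ((𝓢.metric.causalFuture 𝓢.timeOrientation A ∩
        𝓢.metric.chronologicalPast 𝓢.timeOrientation C) \ C) ∩ closure F ⊆
        𝓢.metric.causalPast 𝓢.timeOrientation S) :
    (𝓢.metric.causalFuture 𝓢.timeOrientation A ∩
        𝓢.metric.chronologicalPast 𝓢.timeOrientation C) \ F ⊆
      𝓢.metric.causalPast 𝓢.timeOrientation S := by
  classical
  have hn : (2 : ℕ∞ω) ≤ ((⊤ : ℕ∞) : ℕ∞ω) := WithTop.coe_le_coe.mpr le_top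
  have htrans : ∀ X : Set 𝓢.carrier,
      𝓢.metric.causalPast 𝓢.timeOrientation (𝓢.metric.causalPast 𝓢.timeOrientation X) =
        𝓢.metric.causalPast 𝓢.timeOrientation X :=
    fun X ↦ LorentzianMetric.causalFuture_causalFuture_eq (τ := 𝓢.timeOrientation.reverse) hn X
  have htransF : ∀ X : Set 𝓢.carrier,
      𝓢.metric.causalFuture 𝓢.timeOrientation (𝓢.metric.causalFuture 𝓢.timeOrientation X) =
        𝓢.metric.causalFuture 𝓢.timeOrientation X :=
    fun X ↦ LorentzianMetric.causalFuture_causalFuture_eq hn X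
  rintro p ⟨⟨hpA, hpC⟩, hpF⟩
  by_cases hpc : p ∈ C
  · exact K1 ⟨hpc, hpF⟩
  obtain ⟨c, hc, γ, a, b, hab, hγ, hγa, hγb⟩ := hpC
  have hcont : ∀ t ∈ Icc a b, ContinuousAt γ t := fun t ht ↦ (hγ t ht).1.continuousAt
  set T : Set ℝ := {t | t ∈ Icc a b ∧ γ t ∈ C} with hT
  have haT : a ∈ T := ⟨⟨le_rfl, hab.le⟩, by rw [hγa]; exact hc⟩
  have hTne : T.Nonempty := ⟨a, haT⟩
  have hTbdd : BddAbove T := ⟨b, fun t ht ↦ ht.1.2⟩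
  set t₀ := sSup T with ht₀
  have ht₀a : a ≤ t₀ := le_csSup hTbdd haT
  have ht₀b : t₀ ≤ b := csSup_le hTne fun t ht ↦ ht.1.2
  have ht₀I : t₀ ∈ Icc a b := ⟨ht₀a, ht₀b⟩
  -- the entry point `z = γ t₀` is uncharted
  have hzC : γ t₀ ∉ C := by
    intro hzC
    rcases eq_or_lt_of_le ht₀b with h | h
    · apply hpc
      rw [← hγb, ← h]
      exact hzC
    · have hnhds : γ ⁻¹' C ∈ 𝓝 t₀ := (hcont t₀ ht₀I).preimage_mem_nhds (hC.mem_nhds hzC)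
      obtain ⟨ε, hε, hball⟩ := Metric.mem_nhds_iff.1 hnhds
      have ht₀t : t₀ < min (t₀ + ε / 2) b := lt_min (by linarith) h
      have htT : min (t₀ + ε / 2) b ∈ T := by
        refine ⟨⟨ht₀a.trans ht₀t.le, min_le_right _ _⟩, hball ?_⟩
        rw [Metric.mem_ball, Real.dist_eq, abs_of_pos (sub_pos.2 ht₀t)]
        have : min (t₀ + ε / 2) b ≤ t₀ + ε / 2 := min_le_left _ _
        linarith
      exact absurd (le_csSup hTbdd htT) (not_le.2 ht₀t)
  have hat₀ : a < t₀ := lt_of_le_of_ne ht₀a fun h ↦ hzC (by rw [← h, hγa]; exact hc)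
  have hzclos : γ t₀ ∈ closure (γ '' T) :=
    (hcont t₀ ht₀I).continuousWithinAt.mem_closure_image (csSup_mem_closure hTne hTbdd)
  -- `p ≤ z`
  have hpz : p ∈ 𝓢.metric.causalPast 𝓢.timeOrientation {γ t₀} := by
    rcases eq_or_lt_of_le ht₀b with h | h
    · rw [h, hγb]
      exact LorentzianMetric.subset_causalPast _ _ _ rfl
    · exact Or.inr ⟨γ t₀, rfl, γ, t₀, b, h,
        (hγ.mono (Icc_subset_Icc_left ht₀a)).isFutureCausalCurveOn, rfl, hγb⟩
  by_cases hA : ∃ t ∈ T, γ t ∉ F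
  · -- Case A: a charted NON-late point on the curve; K1 and transitivity
    obtain ⟨t, htT, htF⟩ := hA
    have htb : t < b := lt_of_le_of_ne htT.1.2 fun h ↦ hpc (by rw [← hγb, ← h]; exact htT.2)
    have hK : γ t ∈ 𝓢.metric.causalPast 𝓢.timeOrientation S := K1 ⟨htT.2, htF⟩
    have hpJ : p ∈ 𝓢.metric.causalPast 𝓢.timeOrientation {γ t} :=
      Or.inr ⟨γ t, rfl, γ, t, b, htb,
        (hγ.mono (Icc_subset_Icc_left htT.1.1)).isFutureCausalCurveOn, rfl, hγb⟩
    rw [← htrans S]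
    exact LorentzianMetric.causalFuture_mono (singleton_subset_iff.2 hK) hpJ
  · -- Case B: every charted point of the curve is late; the entry point is an uncharted floor point
    push_neg at hA
    have hzF : γ t₀ ∈ closure F :=
      closure_mono (image_subset_iff.2 fun t ht ↦ hA t ht) hzclos
    have hzI : γ t₀ ∈ 𝓢.metric.chronologicalPast 𝓢.timeOrientation C :=
      ⟨c, hc, γ, a, t₀, hat₀, hγ.mono (Icc_subset_Icc_right ht₀b), hγa, rfl⟩
    have hzA : γ t₀ ∈ 𝓢.metric.causalFuture 𝓢.timeOrientation A := by
      have hzp : γ t₀ ∈ 𝓢.metric.causalFuture 𝓢.timeOrientation {p} :=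
        LorentzianMetric.mem_causalPast_singleton_iff.1 hpz
      rw [← htransF A]
      exact LorentzianMetric.causalFuture_mono (singleton_subset_iff.2 hpA) hzp
    have hK := K2 ⟨⟨⟨hzA, hzI⟩, hzC⟩, hzF⟩
    rw [← htrans S]
    exact LorentzianMetric.causalFuture_mono (singleton_subset_iff.2 hK) hpz

/-- `HonestCore` — verbatim copy of the crux's let-bound `Hc`. -/
def HcPred (𝓢 : Spacetime.{0} 4) (O : Set 𝓢.carrier) (k : ℕ) (d : FinalStateDecomposition 𝓢 O k)
    (R₀ : ℝ) : Prop :=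
  let B := d.background; let t := fun i ↦ (B i).time; let r := fun i ↦ (B i).radius; let Ψ := d.chart; (∀ i, Kerr.IsSubextremal (d.mass i) (d.spin i) ∧ 100 * d.mass i ≤ R₀ ∧ 0 < ((d.motion i).1 : E4 ≃L[ℝ] E4) (E4.basisVector 0) 0) ∧ (∀ i (ϱ τ₂ : ℝ), R₀ ≤ ϱ → d.τ₀ < τ₂ → Ψ i '' {x | d.τ₀ < t i x.1 ∧ t i x.1 < τ₂ ∧ r i x.1 < ϱ} ⊆ 𝓢.metric.causalPast 𝓢.timeOrientation (Ψ i '' (B i).truncTimeSlab ϱ τ₂)) ∧ (∀ i (τ' : ℝ) (ϱ : ℝ → ℝ), Continuous ϱ → d.τ₀ < τ' → let A := Ψ i '' {x | τ' ≤ t i x.1 ∧ r i x.1 ≤ ϱ (t i x.1)}; closure A ∩ O ⊆ A) ∧ (∀ y : d.flatDomain, d.τ₀ < y.1 0 → 𝓢.timeOrientation.IsFutureDirected (mfderiv 𝓘(ℝ, E4) (𝓡 4) d.flatChart y (E4.basisVector 0)))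

/-- `SEAMED` — verbatim copy of the crux's let-bound `Sm`. -/
def SmPred (𝓢 : Spacetime.{0} 4) (O : Set 𝓢.carrier) (d : FinalStateDecomposition 𝓢 O 2)
    (R : Fin d.N → ℝ → ℝ) (R₀ : ℝ) : Prop :=
  let B := d.background; let t := fun i ↦ (B i).time; let r := fun i ↦ (B i).radius; let Λ := fun i ↦ ((d.motion i).1 : E4 ≃L[ℝ] E4); let Φ := d.flatChart; let Ψ := d.chart; let ρ := d.excision; (∀ i, Monotone (R i) ∧ Continuous (R i) ∧ ∀ s, R₀ + 4 ≤ R i s ∧ R₀ ≤ ρ i s) ∧ (∀ i, Tendsto (fun τ ↦ 𝓢.truncDeviationCk (B i) (Ψ i) 2 (R i τ) τ) atTop (𝓝 0)) ∧ supCkENorm (Subtype.val '' {y : d.flatDomain | d.τ₀ ≤ y.1 0}) 0 (𝓢.deviationExtend (Minkowski.backgroundOn d.flatDomain) Φ) ≤ 10⁻¹ ∧ (∀ i, supCkENorm (Subtype.val '' {x : (B i).domain | (d.τ₀ ≤ t i x.1 ∨ d.τ₀ ≤ x.1 0) ∧ R₀ ≤ r i x.1 ∧ r i x.1 ≤ R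 i (t i x.1)}) 0 (𝓢.deviationExtend (B i) (Ψ i)) ≤ ENNReal.ofReal (1 / (10 * ‖(Λ i : E4 →L[ℝ] E4)‖ ^ 2))) ∧ (∀ i (x : (B i).domain), (d.τ₀ ≤ t i x.1 ∨ d.τ₀ ≤ x.1 0) → R₀ ≤ r i x.1 → r i x.1 ≤ R i (t i x.1) → 𝓢.timeOrientation.IsFutureDirected (mfderiv 𝓘(ℝ, E4) (𝓡 4) (Ψ i) x ((Λ i) (E4.basisVector 0)))) ∧ (∀ i (y : E4) (hy : y ∈ (B i).domain), d.τ₀ ≤ y 0 → (∀ j, ρ j (y 0) < r j y) → r i y ≤ R i (t i y) + 1 → ∃ hy' : y ∈ d.flatDomain, Ψ i ⟨y, hy⟩ = Φ ⟨y, hy'⟩) ∧ (∀ y : d.flatDomain, d.τ₀ ≤ y.1 0 → ∀ j, ρ j (y.1 0) < r j y.1) ∧ (∀ j (y : E4), d.τ₀ ≤ y 0 → r j y ≤ ρ j (y 0) → r j y + 2 ≤ R j (t j y)) ∧ (∀ j (y : E4), d.τ₀ ≤ t j y → r j y ≤ R j (t j y) + 2 → t j y ≤ y 0) ∧ (∀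 j, Ψ j '' {x | d.τ₀ < t j x.1 ∧ R j (t j x.1) + 1 < r j x.1} ⊆ d.radiationZone) ∧ (∀ τ' : ℝ, d.τ₀ < τ' → closure (Φ '' {y | τ' ≤ y.1 0}) ⊆ Φ '' {y | τ' ≤ y.1 0} ∪ ⋃ j, Ψ j '' {x | τ' ≤ x.1 0 ∧ r j x.1 = ρ j (x.1 0)}) ∧ (∀ j j' (y : E4), j ≠ j' → (d.τ₀ ≤ y 0 ∨ d.τ₀ ≤ t j y) → r j y ≤ R j (t j y) + 1 → R j' (t j' y) + 1 < r j' y)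

/-- ESCALATOR (the one hole-chart move used by both K1 and K2): along the hole's own time direction
`Λⱼ e₀` the hole clock rises at unit rate at constant rest-frame radius, the lab clock does not
decrease (orthochronous boost), and `Sm5` certifies the velocity on `R₀ ≤ r ≤ Rⱼ(t)` from
hole-late OR flat-late points; with `R` monotone a tube point with hole clock `≤ τ₁` is causally
below the truncated disc `{t = τ₁, r ≤ Rⱼ(τ₁)}`. -/
theorem escalator (𝓢 : Spacetime.{0} 4) (O : Set 𝓢.carrier) (d : FinalStateDecomposition 𝓢 O 2)
    (R : Fin d.N → ℝ → ℝ) (R₀ : ℝ)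
    (hmono : ∀ i, Monotone (R i))
    (horth : ∀ i, 0 < ((d.motion i).1 : E4 ≃L[ℝ] E4) (E4.basisVector 0) 0)
    (hSm5 : ∀ i (x : (d.background i).domain),
      (d.τ₀ ≤ (d.background i).time x.1 ∨ d.τ₀ ≤ x.1 0) → R₀ ≤ (d.background i).radius x.1 →
      (d.background i).radius x.1 ≤ R i ((d.background i).time x.1) →
      𝓢.timeOrientation.IsFutureDirected
        (mfderiv 𝓘(ℝ, E4) (𝓡 4) (d.chart i) x (((d.motion i).1 : E4 ≃L[ℝ] E4) (E4.basisVector 0))))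
    (i : Fin d.N) (x : (d.background i).domain) (τ₁ : ℝ)
    (hlate : d.τ₀ ≤ (d.background i).time x.1 ∨ d.τ₀ ≤ x.1 0)
    (hr₀ : R₀ ≤ (d.background i).radius x.1)
    (hrR : (d.background i).radius x.1 ≤ R i ((d.background i).time x.1))
    (ht : (d.background i).time x.1 ≤ τ₁) :
    d.chart i x ∈ 𝓢.metric.causalPast 𝓢.timeOrientation
      (d.chart i '' (d.background i).truncTimeSlab (R i τ₁) τ₁) := by
  sorry

/-- K2 — UNCHARTED FLOOR: an uncharted exterior point in the closure of the certified-late region after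
`τ₁ > τ₀` is causally below the certified slab at `τ₁`. Consumes `Sm11` and `Hc(c)` (closure clauses,
at level `τ₁` itself), `Sm1`, `Sm5`, `Sm8`, orthochronicity: the closure point is a HOLE-EARLY tube wall
point (every other alternative is charted), and the escalator takes it to the disc. -/
theorem floor_K2 (𝓢 : Spacetime.{0} 4) (O : Set 𝓢.carrier) (d : FinalStateDecomposition 𝓢 O 2)
    (R : Fin d.N → ℝ → ℝ) (R₀ : ℝ) (hc : HcPred 𝓢 O 2 d R₀) (hs : SmPred 𝓢 O d R R₀)
    (τ₁ : ℝ) (hτ₁ : d.τ₀ < τ₁) :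
    (O \ d.charted) ∩ closure (certifiedLate d R τ₁) ⊆
      𝓢.metric.causalPast 𝓢.timeOrientation (certifiedSlab d R τ₁) := by
  sorry

/-- K1 — CHARTED ASCENT: a charted point not in the certified-late region after `τ₁` is causally below
the certified slab at `τ₁` (good representative: flat-late `y⁰ ≤ τ₁` → `∂₀`-ray until the flat slab or
the first exit from `U₀`, one-atlas switch just before the wall, escalator; certified hole-late → escalator
or anchoring `Hc(b)` below `R₀`; collar / far-leaf representatives convert to flat-late ones by
`Sm6,8,9,10,12`). -/
theorem ascent_K1 (𝓢 : Spacetime.{0} 4) (O : Set 𝓢.carrier) (d : FinalStateDecomposition 𝓢 O 2)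
    (R : Fin d.N → ℝ → ℝ) (R₀ : ℝ) (hc : HcPred 𝓢 O 2 d R₀) (hs : SmPred 𝓢 O d R R₀)
    (τ₁ : ℝ) (hτ₁ : d.τ₀ < τ₁) :
    d.charted \ certifiedLate d R τ₁ ⊆
      𝓢.metric.causalPast 𝓢.timeOrientation (certifiedSlab d R τ₁) := by
  sorry

/-- The charted late region is open (each late chart is an open embedding of its late region). -/
theorem isOpen_charted (𝓢 : Spacetime.{0} 4) (O : Set 𝓢.carrier) (d : FinalStateDecomposition 𝓢 O 2) :
    IsOpen d.charted := by
  refine IsOpen.union ?_ (isOpen_iUnion fun i ↦ ?_)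
  · have h := d.isLateChart_flat.isOpenEmbedding.isOpen_range
    rwa [Set.range_restrict] at h
  · have h := (d.isLateChart i).isOpenEmbedding.isOpen_range
    rwa [Set.range_restrict] at h

/-- COMPOSITION: the crux, by name, from the kernel with `A = range 𝒟.embed`, `C = d.charted`,
`F = certifiedLate d R τ₁`, `S = certifiedSlab d R τ₁`; clause (i) of `HasExhaustiveCharts` is `Sm2`. -/
theorem SeamedChartsExhaust_of_kernel :
    _root_.Summit.FinalStateConjecture.FinalStateConjecture.Theses.StarvedNecks.SeamedChartsExhaust := by
  intro X _ _ _ _ D hD 𝒟 h𝒟 O d R R₀ hO hc hs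
  refine ⟨R, hs.2.1, fun τ₁ hτ₁ => ?_⟩
  have hK := kernel_dichotomy 𝒟.toSpacetime (range 𝒟.embed) d.charted (certifiedLate d R τ₁)
    (certifiedSlab d R τ₁) (isOpen_charted _ _ d) (ascent_K1 _ O d R R₀ hc hs τ₁ hτ₁) ?_
  · intro p hp
    refine hK ⟨?_, hp.2⟩
    have := hp.1
    rw [hO] at this
    exact this
  · intro z hz
    refine floor_K2 _ O d R R₀ hc hs τ₁ hτ₁ ⟨⟨?_, hz.1.2⟩, hz.2⟩
    rw [hO]
    exact hz.1.1

end Summit.FinalStateConjecture.FinalStateConjecture.Cruxes.SeamedChartsExhaust.OneCurveDichotomy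

end
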